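import Summits.KontsevichZagierPeriods.KontsevichZagierPeriods.Theorems.HyperbolicBlochPachnerTwoThree

/-!
# `PachnerTwoThree`: tightness on the inside, part 1 — `q̂` on an edge or at a vertex

Negative/tightness knowledge for the crux `HyperbolicBloch.PachnerTwoThree`
(stmt-KontsevichZagierPeriods-3470; refuter, cdisprove g3), complementing
`Negative/WithoutInteriorAE.lean` (an interior hypothesis DELETED ⇒ false) from the other side:
the three strict interior hypotheses `0 < L u v q̂`, `0 < L v w q̂`, `0 < L w u q̂` are NOT
load-bearing in their strictness.  Weakened simultaneously to `0 ≤ …` (closed triangle; the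
non-degeneracy `0 < L u v ŵ` of the counter-clockwise triangle, automatic in the crux, made
explicit) the typed combination is still a KZ relation, for any common integrand
(`pachnerTwoThree_closed_general`, `pachnerTwoThreeClosed_holds`):

* `q̂` on an OPEN EDGE `uv` (`γ = 0 < α, β`): the typed `prism(u,v,q)` is EMPTY and the move
  degenerates to the 2–2 move on the pyramid over the flat ideal quadrilateral `(∞, u, q, v)`
  (`core_edge`, `two_three_pointwise_edge`; null scaffold `{S u v w = 0} ∪ {L w q = 0}`;
  `pachnerTwoThree_edge_general`);
* `q` AT A VERTEX (`q = u`, `eq_vertex`): the inner region and two prisms are empty and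
  `prism(v,w,q) = prism(u,v,w)` (`pachnerTwoThree_vertex_general`);
* cyclic relabelling of the conclusion shape (`Concl`, `concl_of_cyclic`) covers the other edges
  and vertices.

So the boundary of validity of the typed statement passes exactly through the edges: the closed
triangle is inside the truth region, and immediately across an edge (inside the circumcircle)
there are refuting configurations (`Negative/WithoutInteriorAE.lean`; KZ level in the crux work
file `Cruxes/PachnerTwoThree/Disproof.lean` §5c).  Builds on the landed
`Theorems/HyperbolicBlochPachnerTwoThree{,Pointwise,Scaffold}.lean` (identities, `core`,
`pachnerTwoThree_general`, scaffold nullity, `of_sub_three_mem_relations`).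
-/

noncomputable section

open Set MeasureTheory
open Literature.NumberTheory.Transcendental

namespace Summit.KontsevichZagierPeriods.HyperbolicBloch.PachnerTwoThree.ClosedTriangle

section Closed

/-- **Abstract core, edge configuration** (`γ = 0 < α, β`, `K > 0`): the typed `prism(u,v,q)`
is empty and the 2–3 move degenerates to the 2–2 move
`prism(u,v,w) ∪ inner = prism(v,w,q) ∪ prism(w,u,q)` off `{σ = 0} ∪ {Lwq = 0}`. -/
theorem core_edge {α β γ K A a b c σ Luq Lqu Lvq Lqv Lwq Lqw Suvq Svwq Swuq : ℝ}
    (hα : 0 < α) (hβ : 0 < β) (hγ : γ = 0) (hK : 0 < K) (hA : 0 < A)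
    (euq : A * Luq = β * c - γ * b) (equ : A * Lqu = γ * b - β * c)
    (evq : A * Lvq = γ * a - α * c) (eqv : A * Lqv = α * c - γ * a)
    (ewq : A * Lwq = α * b - β * a) (eqw : A * Lqw = β * a - α * b)
    (e₁ : A * Suvq = γ * σ + K * c) (e₂ : A * Svwq = α * σ + K * a)
    (e₃ : A * Swuq = β * σ + K * b)
    (hσ : σ ≠ 0) (hw : Lwq ≠ 0) :
    ((0 < c ∧ 0 < a ∧ 0 < b ∧ 0 < σ) ∨ (σ < 0 ∧ 0 < Suvq ∧ 0 < Svwq ∧ 0 < Swuq)) ↔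
    ((0 < c ∧ 0 < Lvq ∧ 0 < Lqu ∧ 0 < Suvq) ∨ (0 < a ∧ 0 < Lwq ∧ 0 < Lqv ∧ 0 < Svwq) ∨
      (0 < b ∧ 0 < Luq ∧ 0 < Lqw ∧ 0 < Swuq)) := by
  subst hγ
  simp only [zero_mul, zero_sub, sub_zero, zero_add] at euq equ evq eqv e₁
  have t : ∀ {X Y : ℝ}, A * X = Y → (0 < X ↔ 0 < Y) := fun e => by
    rw [← e, mul_pos_iff_of_pos_left hA]
  have h₃ : α * b - β * a ≠ 0 := by rw [← ewq]; exact mul_ne_zero hA.ne' hw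
  rw [t euq, t equ, t evq, t eqv, t ewq, t eqw, t e₁, t e₂, t e₃]
  constructor
  · rintro (⟨hc, ha, hb, hs⟩ | ⟨hs, k1, k2, k3⟩)
    · rcases lt_or_gt_of_ne h₃ with k | k
      · exact Or.inr (Or.inr ⟨hb, mul_pos hβ hc, by linarith,
          add_pos (mul_pos hβ hs) (mul_pos hK hb)⟩)
      · exact Or.inr (Or.inl ⟨ha, k, mul_pos hα hc, add_pos (mul_pos hα hs) (mul_pos hK ha)⟩)
    · have hc : 0 < c := pos_of_mul_pos_right k1 hK.le
      have hασ : α * σ < 0 := mul_neg_of_pos_of_neg hα hs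
      have hβσ : β * σ < 0 := mul_neg_of_pos_of_neg hβ hs
      have ha : 0 < a := pos_of_mul_pos_right (by linarith) hK.le
      have hb : 0 < b := pos_of_mul_pos_right (by linarith) hK.le
      rcases lt_or_gt_of_ne h₃ with k | k
      · exact Or.inr (Or.inr ⟨hb, mul_pos hβ hc, by linarith, k3⟩)
      · exact Or.inr (Or.inl ⟨ha, k, mul_pos hα hc, k2⟩)
  · rintro (⟨hc, h2, -, -⟩ | ⟨ha, h3, h2, hs⟩ | ⟨hb, h1, h3, hs⟩)
    · exfalso
      have : 0 < α * c := mul_pos hα hc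
      linarith
    · have hc : 0 < c := pos_of_mul_pos_right h2 hα.le
      have hb : 0 < b := by
        have : 0 < α * b := by linarith [mul_pos hβ ha]
        exact pos_of_mul_pos_right this hα.le
      rcases lt_or_gt_of_ne hσ with k | k
      · refine Or.inr ⟨k, mul_pos hK hc, hs, ?_⟩
        have e : α * (β * σ + K * b) = β * (α * σ + K * a) + K * (α * b - β * a) := by ring
        have : 0 < α * (β * σ + K * b) := by rw [e]; exact add_pos (mul_pos hβ hs) (mul_pos hK h3)
        exact pos_of_mul_pos_right this hα.le
      · exact Or.inl ⟨hc, ha, hb, k⟩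
    · have hc : 0 < c := pos_of_mul_pos_right h1 hβ.le
      have ha : 0 < a := by
        have : 0 < β * a := by linarith [mul_pos hα hb]
        exact pos_of_mul_pos_right this hβ.le
      rcases lt_or_gt_of_ne hσ with k | k
      · refine Or.inr ⟨k, mul_pos hK hc, ?_, hs⟩
        have e : β * (α * σ + K * a) = α * (β * σ + K * b) + K * (β * a - α * b) := by ring
        have : 0 < β * (α * σ + K * a) := by rw [e]; exact add_pos (mul_pos hα hs) (mul_pos hK h3)
        exact pos_of_mul_pos_right this hβ.le
      · exact Or.inl ⟨hc, ha, hb, k⟩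

variable {L : ℂ → ℂ → (Fin 3 → ℝ) → ℝ} {S : ℂ → ℂ → ℂ → (Fin 3 → ℝ) → ℝ}
variable (hL : ∀ u v p, L u v p = (v.re - u.re) * (p 1 - u.im) - (v.im - u.im) * (p 0 - u.re))
  (hS : ∀ u v w p, S u v w p = (p 0 ^ 2 + p 1 ^ 2 + p 2 ^ 2) * (u.re * (v.im - w.im) - u.im * (v.re - w.re) + (v.re * w.im - v.im * w.re)) - p 0 * (Complex.normSq u * (v.im - w.im) - u.im * (Complex.normSq v - Complex.normSq w) + (Complex.normSq v * w.im - v.im * Complex.normSq w)) + p 1 * (Complex.normSq u * (v.re - w.re) - u.re * (Complex.normSq v - Complex.normSq w) + (Complex.normSq v * w.re - v.re * Complex.normSq w)) - (Complex.normSq u * (v.re * w.im - v.im * w.re) - u.re * (Complex.normSq v * w.im - v.im * Complex.normSq w) + u.im * (Complex.normSq v * w.re - v.re * Complex.normSq w)))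

include hL in
/-- `L u u = 0`. -/
theorem L_self (u : ℂ) (p : Fin 3 → ℝ) : L u u p = 0 := by simp only [hL]; ring

include hL in
/-- The three edge forms at `q̂` sum to the double area `L u v ŵ`. -/
theorem L_sum_vert (u v w q : ℂ) :
    L u v ![q.re, q.im, 0] + L v w ![q.re, q.im, 0] + L w u ![q.re, q.im, 0] = L u v ![w.re, w.im, 0] := by
  simp only [hL, vec3_zero, vec3_one]; ring

include hS in
/-- `S` is invariant under cyclic permutation of the vertices. -/
theorem S_cyclic (u v w : ℂ) (p : Fin 3 → ℝ) : S v w u p = S u v w p := by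
  simp only [hS]; ring

include hL in
/-- On the open edge `uv` the endpoints are distinct: `|u − v|² > 0`. -/
theorem dist_sq_pos_of_edge {u v w q : ℂ} (hα : 0 < L v w ![q.re, q.im, 0]) (hβ : 0 < L w u ![q.re, q.im, 0]) :
    0 < (u.re - v.re) ^ 2 + (u.im - v.im) ^ 2 := by
  by_contra hle
  push Not at hle
  have e1 : u.re - v.re = 0 := by nlinarith [sq_nonneg (u.re - v.re), sq_nonneg (u.im - v.im)]
  have e2 : u.im - v.im = 0 := by nlinarith [sq_nonneg (u.re - v.re), sq_nonneg (u.im - v.im)]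
  have : L v w ![q.re, q.im, 0] = -L w u ![q.re, q.im, 0] := by
    simp only [hL, vec3_zero, vec3_one]
    have h1' : v.re = u.re := by linarith
    have h2' : v.im = u.im := by linarith
    rw [h1', h2']; ring
  linarith

include hL hS in
/-- Edge power identity: with `γ = 0`, `(α + β) · S u v w q̂ = −|u − v|² · α β`. -/
theorem power_hat_edge {u v w q : ℂ} (hγ : L u v ![q.re, q.im, 0] = 0) :
    (L v w ![q.re, q.im, 0] + L w u ![q.re, q.im, 0]) * S u v w ![q.re, q.im, 0]
      = -(((u.re - v.re) ^ 2 + (u.im - v.im) ^ 2) * L v w ![q.re, q.im, 0] * L w u ![q.re, q.im, 0]) := by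
  linear_combination (power_hat hL hS u v w q)
    - (((v.re - w.re) ^ 2 + (v.im - w.im) ^ 2) * L w u ![q.re, q.im, 0]
        + ((w.re - u.re) ^ 2 + (w.im - u.im) ^ 2) * L v w ![q.re, q.im, 0] + S u v w ![q.re, q.im, 0]) * hγ

include hL hS in
/-- A point of the open edge `uv` lies strictly inside the circumcircle: `S u v w q̂ < 0`. -/
theorem S_hat_neg_edge {u v w q : ℂ} (hγ : L u v ![q.re, q.im, 0] = 0) (hα : 0 < L v w ![q.re, q.im, 0])
    (hβ : 0 < L w u ![q.re, q.im, 0]) : S u v w ![q.re, q.im, 0] < 0 := by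
  have hA : 0 < L v w ![q.re, q.im, 0] + L w u ![q.re, q.im, 0] := by linarith
  have huv := dist_sq_pos_of_edge hL hα hβ
  have hE : 0 < ((u.re - v.re) ^ 2 + (u.im - v.im) ^ 2) * L v w ![q.re, q.im, 0] * L w u ![q.re, q.im, 0] := by
    positivity
  have hAS : (L v w ![q.re, q.im, 0] + L w u ![q.re, q.im, 0]) * S u v w ![q.re, q.im, 0] < 0 := by
    rw [power_hat_edge hL hS hγ]; linarith
  exact neg_of_mul_neg_right hAS hA.le

include hL hS in
/-- **Pointwise 2–3 identity on an edge** (`q̂` on the open edge `uv`): off the scaffold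
`{S u v w = 0} ∪ {L w q = 0}` the typed two sides contain the same points (the typed
`prism(u,v,q)` being empty, this is a 2–2 identity). -/
theorem two_three_pointwise_edge {u v w q : ℂ} (hγ : L u v ![q.re, q.im, 0] = 0) (hα : 0 < L v w ![q.re, q.im, 0])
    (hβ : 0 < L w u ![q.re, q.im, 0]) {p : Fin 3 → ℝ} (hσ : S u v w p ≠ 0) (hw : L w q p ≠ 0) :
    ((0 < p 2 ∧ 0 < L u v p ∧ 0 < L v w p ∧ 0 < L w u p ∧ 0 < S u v w p) ∨
      (0 < p 2 ∧ S u v w p < 0 ∧ 0 < S u v q p ∧ 0 < S v w q p ∧ 0 < S w u q p)) ↔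
    ((0 < p 2 ∧ 0 < L u v p ∧ 0 < L v q p ∧ 0 < L q u p ∧ 0 < S u v q p) ∨
      (0 < p 2 ∧ 0 < L v w p ∧ 0 < L w q p ∧ 0 < L q v p ∧ 0 < S v w q p) ∨
      (0 < p 2 ∧ 0 < L w u p ∧ 0 < L u q p ∧ 0 < L q w p ∧ 0 < S w u q p)) := by
  by_cases ht : 0 < p 2
  · simp only [ht, true_and]
    have hA : 0 < L u v ![q.re, q.im, 0] + L v w ![q.re, q.im, 0] + L w u ![q.re, q.im, 0] := by linarith
    have hK : 0 < -S u v w ![q.re, q.im, 0] := by linarith [S_hat_neg_edge hL hS hγ hα hβ]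
    exact core_edge hα hβ hγ hK hA (spoke_uq hL u v w q p) (spoke_qu hL u v w q p)
      (spoke_vq hL u v w q p) (spoke_qv hL u v w q p) (spoke_wq hL u v w q p)
      (spoke_qw hL u v w q p) (sphere_uvq hL hS u v w q p) (sphere_vwq hL hS u v w q p)
      (sphere_wuq hL hS u v w q p) hσ hw
  · simp only [ht, false_and, or_self]

include hL hS in
/-- The edge scaffold `{S u v w = 0} ∪ {L w q = 0}` is null. -/
theorem volume_scaffold_edge_eq_zero {u v w q : ℂ} (hγ : L u v ![q.re, q.im, 0] = 0)
    (hα : 0 < L v w ![q.re, q.im, 0]) (hβ : 0 < L w u ![q.re, q.im, 0]) :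
    volume {p : Fin 3 → ℝ | S u v w p = 0 ∨ L w q p = 0} = 0 := by
  have hSq : S u v w ![q.re, q.im, 0] ≠ 0 := (S_hat_neg_edge hL hS hγ hα hβ).ne
  have hw : L w q ![v.re, v.im, 0] ≠ 0 := by rw [L_wq_hat_v hL]; exact hα.ne'
  simp only [setOf_or]
  exact measure_union_null (scaffold_volume_setOf_S_eq_zero hS hSq) (scaffold_volume_setOf_L_eq_zero hL hw)

include hL hS in
/-- **The 2–3 relation with `q̂` ON the open edge `uv` is still a KZ relation** (any common
integrand; the typed `prism(u,v,q)` is empty, `r₁` is a null representation). -/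
theorem pachnerTwoThree_edge_general {u v w q : ℂ} (hγ : L u v ![q.re, q.im, 0] = 0)
    (hα : 0 < L v w ![q.re, q.im, 0]) (hβ : 0 < L w u ![q.re, q.im, 0]) (f : (Fin 3 → ℝ) → ℝ)
    (rP rI r₁ r₂ r₃ : KZ.IntegralRep 3)
    (hP : rP.domain = {p | 0 < p 2 ∧ 0 < L u v p ∧ 0 < L v w p ∧ 0 < L w u p ∧ 0 < S u v w p})
    (hI : rI.domain = {p | 0 < p 2 ∧ S u v w p < 0 ∧ 0 < S u v q p ∧ 0 < S v w q p ∧ 0 < S w u q p})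
    (hr₁ : r₁.domain = {p | 0 < p 2 ∧ 0 < L u v p ∧ 0 < L v q p ∧ 0 < L q u p ∧ 0 < S u v q p})
    (hr₂ : r₂.domain = {p | 0 < p 2 ∧ 0 < L v w p ∧ 0 < L w q p ∧ 0 < L q v p ∧ 0 < S v w q p})
    (hr₃ : r₃.domain = {p | 0 < p 2 ∧ 0 < L w u p ∧ 0 < L u q p ∧ 0 < L q w p ∧ 0 < S w u q p})
    (fP : EqOn rP.integrand f rP.domain) (fI : EqOn rI.integrand f rI.domain)
    (f₁ : EqOn r₁.integrand f r₁.domain) (f₂ : EqOn r₂.integrand f r₂.domain)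
    (f₃ : EqOn r₃.integrand f r₃.domain) :
    KZ.of rP + KZ.of rI - KZ.of r₁ - KZ.of r₂ - KZ.of r₃ ∈ KZ.relations := by
  set Z : Set (Fin 3 → ℝ) := {p | S u v w p = 0 ∨ L w q p = 0} with hZ_def
  have hZ : volume Z = 0 := volume_scaffold_edge_eq_zero hL hS hγ hα hβ
  have hpt : ∀ p, p ∉ Z → ((p ∈ rP.domain ∨ p ∈ rI.domain) ↔
      (p ∈ r₁.domain ∨ p ∈ r₂.domain ∨ p ∈ r₃.domain)) := by
    intro p hp
    simp only [hZ_def, mem_setOf_eq, not_or] at hp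
    rw [hP, hI, hr₁, hr₂, hr₃]
    simp only [mem_setOf_eq]
    exact two_three_pointwise_edge hL hS hγ hα hβ hp.1 hp.2
  have hdisj : Disjoint rP.domain rI.domain := by
    rw [Set.disjoint_left]
    intro p hp hp'
    rw [hP] at hp
    rw [hI] at hp'
    exact absurd hp.2.2.2.2 (not_lt.mpr hp'.2.1.le)
  set r := rP.glue rI hdisj with hr_def
  have hglue : KZ.of r - KZ.of rP - KZ.of rI ∈ KZ.relations :=
    KZ.domainAddRel_subset_relations (KZ.IntegralRep.of_glue_sub_sub_mem_domainAddRel rP rI hdisj)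
  have hrint : EqOn r.integrand f r.domain := by
    intro p hp
    rcases hp with hp | hp
    · rw [KZ.IntegralRep.eqOn_integrand_glue_left rP rI hdisj hp]; exact fP hp
    · rw [KZ.IntegralRep.eqOn_integrand_glue_right rP rI hdisj hp]; exact fI hp
  have sub₁ : r₁.domain \ r.domain ⊆ Z := by
    intro p hp
    by_contra hz
    exact hp.2 ((hpt p hz).mpr (Or.inl hp.1))
  have sub₂ : r₂.domain \ r.domain ⊆ Z := by
    intro p hp
    by_contra hz
    exact hp.2 ((hpt p hz).mpr (Or.inr (Or.inl hp.1)))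
  have sub₃ : r₃.domain \ r.domain ⊆ Z := by
    intro p hp
    by_contra hz
    exact hp.2 ((hpt p hz).mpr (Or.inr (Or.inr hp.1)))
  have subc : r.domain \ (r₁.domain ∪ r₂.domain ∪ r₃.domain) ⊆ Z := by
    intro p hp
    by_contra hz
    have := (hpt p hz).mp hp.1
    rcases this with h | h | h
    · exact hp.2 (Or.inl (Or.inl h))
    · exact hp.2 (Or.inl (Or.inr h))
    · exact hp.2 (Or.inr h)
  have e12 : r₁.domain ∩ r₂.domain = ∅ := by
    ext p
    simp only [mem_inter_iff, mem_empty_iff_false, iff_false, not_and]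
    intro hp hp'
    rw [hr₁] at hp
    rw [hr₂] at hp'
    have := L_anti hL v q p
    linarith [hp.2.2.1, hp'.2.2.2.1]
  have e13 : r₁.domain ∩ r₃.domain = ∅ := by
    ext p
    simp only [mem_inter_iff, mem_empty_iff_false, iff_false, not_and]
    intro hp hp'
    rw [hr₁] at hp
    rw [hr₃] at hp'
    have := L_anti hL u q p
    linarith [hp.2.2.2.1, hp'.2.2.1]
  have e23 : r₂.domain ∩ r₃.domain = ∅ := by
    ext p
    simp only [mem_inter_iff, mem_empty_iff_false, iff_false, not_and]
    intro hp hp'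
    rw [hr₂] at hp
    rw [hr₃] at hp'
    have := L_anti hL w q p
    linarith [hp.2.2.1, hp'.2.2.2.1]
  have hsplit : KZ.of r - KZ.of r₁ - KZ.of r₂ - KZ.of r₃ ∈ KZ.relations :=
    of_sub_three_mem_relations r r₁ r₂ r₃ (measure_mono_null sub₁ hZ)
      (measure_mono_null sub₂ hZ) (measure_mono_null sub₃ hZ)
      (fun p hp => by rw [f₁ hp.1, hrint hp.2]) (fun p hp => by rw [f₂ hp.1, hrint hp.2])
      (fun p hp => by rw [f₃ hp.1, hrint hp.2]) (measure_mono_null subc hZ)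
      (by rw [e12, measure_empty]) (by rw [e13, measure_empty]) (by rw [e23, measure_empty])
  have e : KZ.of rP + KZ.of rI - KZ.of r₁ - KZ.of r₂ - KZ.of r₃ =
      (KZ.of r - KZ.of r₁ - KZ.of r₂ - KZ.of r₃) - (KZ.of r - KZ.of rP - KZ.of rI) := by abel
  rw [e]
  exact KZ.relations.sub_mem hsplit hglue

include hL in
/-- If `q̂` lies on the lines `uv` and `wu` of a non-degenerate triangle then `q = u`. -/
theorem eq_vertex {u v w q : ℂ} (hγ : L u v ![q.re, q.im, 0] = 0) (hβ : L w u ![q.re, q.im, 0] = 0)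
    (hA : 0 < L u v ![w.re, w.im, 0]) : q = u := by
  have kγ := hγ
  have kβ := hβ
  have kA := hA
  simp only [hL, vec3_zero, vec3_one] at kγ kβ kA
  have hre : ((v.re - u.re) * (w.im - u.im) - (v.im - u.im) * (w.re - u.re)) * (q.re - u.re) = 0 := by
    linear_combination (w.re - u.re) * kγ + (v.re - u.re) * kβ
  have him : ((v.re - u.re) * (w.im - u.im) - (v.im - u.im) * (w.re - u.re)) * (q.im - u.im) = 0 := by
    linear_combination (w.im - u.im) * kγ + (v.im - u.im) * kβ
  have h1 : q.re - u.re = 0 := (mul_eq_zero.mp hre).resolve_left kA.ne'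
  have h2 : q.im - u.im = 0 := (mul_eq_zero.mp him).resolve_left kA.ne'
  exact Complex.ext (by linarith) (by linarith)

include hS in
/-- `S` vanishes when the first and third vertices coincide. -/
theorem S_self₁₃ (u v : ℂ) (p : Fin 3 → ℝ) : S u v u p = 0 := by
  simp only [hS]; ring

include hL hS in
/-- **The 2–3 relation with `q = u` (a vertex) is a KZ relation**: the typed inner region and
the prisms `prism(u,v,q)`, `prism(w,u,q)` are EMPTY, and `prism(v,w,q) = prism(u,v,w)`. -/
theorem pachnerTwoThree_vertex_general {u v w q : ℂ} (hγ : L u v ![q.re, q.im, 0] = 0)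
    (hβ : L w u ![q.re, q.im, 0] = 0) (hA : 0 < L u v ![w.re, w.im, 0]) (f : (Fin 3 → ℝ) → ℝ)
    (rP rI r₁ r₂ r₃ : KZ.IntegralRep 3)
    (hP : rP.domain = {p | 0 < p 2 ∧ 0 < L u v p ∧ 0 < L v w p ∧ 0 < L w u p ∧ 0 < S u v w p})
    (hI : rI.domain = {p | 0 < p 2 ∧ S u v w p < 0 ∧ 0 < S u v q p ∧ 0 < S v w q p ∧ 0 < S w u q p})
    (hr₁ : r₁.domain = {p | 0 < p 2 ∧ 0 < L u v p ∧ 0 < L v q p ∧ 0 < L q u p ∧ 0 < S u v q p})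
    (hr₂ : r₂.domain = {p | 0 < p 2 ∧ 0 < L v w p ∧ 0 < L w q p ∧ 0 < L q v p ∧ 0 < S v w q p})
    (hr₃ : r₃.domain = {p | 0 < p 2 ∧ 0 < L w u p ∧ 0 < L u q p ∧ 0 < L q w p ∧ 0 < S w u q p})
    (fP : EqOn rP.integrand f rP.domain) (f₂ : EqOn r₂.integrand f r₂.domain) :
    KZ.of rP + KZ.of rI - KZ.of r₁ - KZ.of r₂ - KZ.of r₃ ∈ KZ.relations := by
  have hq : q = u := eq_vertex hL hγ hβ hA
  subst q
  have hI0 : rI.domain = ∅ := by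
    rw [hI]; ext p
    simp only [mem_setOf_eq, mem_empty_iff_false, iff_false, not_and, S_self₁₃ hS]
    intro _ _ h; exact absurd h (lt_irrefl 0)
  have h10 : r₁.domain = ∅ := by
    rw [hr₁]; ext p
    simp only [mem_setOf_eq, mem_empty_iff_false, iff_false, not_and, L_self hL]
    intro _ _ _ h; exact absurd h (lt_irrefl 0)
  have h30 : r₃.domain = ∅ := by
    rw [hr₃]; ext p
    simp only [mem_setOf_eq, mem_empty_iff_false, iff_false, not_and, L_self hL]
    intro _ _ h; exact absurd h (lt_irrefl 0)
  have h2P : r₂.domain = rP.domain := by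
    rw [hr₂, hP]; ext p
    simp only [mem_setOf_eq, S_cyclic hS u v w]
    constructor
    · rintro ⟨h0, h1, h2, h3, h4⟩; exact ⟨h0, h3, h1, h2, h4⟩
    · rintro ⟨h0, h1, h2, h3, h4⟩; exact ⟨h0, h2, h3, h1, h4⟩
  have eI : KZ.of rI ∈ KZ.relations :=
    KZ.of_mem_relations_of_volume_eq_zero rI (by rw [hI0, measure_empty])
  have e₁ : KZ.of r₁ ∈ KZ.relations :=
    KZ.of_mem_relations_of_volume_eq_zero r₁ (by rw [h10, measure_empty])
  have e₃ : KZ.of r₃ ∈ KZ.relations :=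
    KZ.of_mem_relations_of_volume_eq_zero r₃ (by rw [h30, measure_empty])
  have e₂ : KZ.of rP - KZ.of r₂ ∈ KZ.relations :=
    KZ.of_sub_of_mem_relations_of_null rP r₂ (by rw [h2P, Set.sdiff_self, measure_empty])
      (by rw [h2P, Set.sdiff_self, measure_empty])
      (fun p hp => by rw [fP hp.1, f₂ hp.2])
  have e : KZ.of rP + KZ.of rI - KZ.of r₁ - KZ.of r₂ - KZ.of r₃ =
      (KZ.of rP - KZ.of r₂) + KZ.of rI - KZ.of r₁ - KZ.of r₃ := by abel
  rw [e]
  exact KZ.relations.sub_mem (KZ.relations.sub_mem (KZ.relations.add_mem e₂ eI) e₁) e₃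

end Closed

end Summit.KontsevichZagierPeriods.HyperbolicBloch.PachnerTwoThree.ClosedTriangle
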